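import Summits.CriticalPhenomena.PercolationContinuityZ3.Theorems.PercNearOneGluingNoHeavyQuantBlockCombStrong
import Summits.CriticalPhenomena.PercolationContinuityZ3.Theorems.PercNearOneGluingNoHeavyQuantBlobWalk
import HarnessLib

/-!
# QUANT lane R8, FAR on trees: the canonical block-comb tail in CROSSING FORM — p1's depth decomposition `TAIL` equals the
# blob-walk first-passage sum, so the strong-regime theorem reads on `Quant.blockComb_count_eq`'s right-hand side

builds on p205010 (kernel theorem, internal audit signed; external expert review pending)

Support file (`--supports stmt-CriticalPhenomena-4575`), QUANT lane typer seat prim-quant-stmt (gen 15); wrapper (W1)/(W2) asked for by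
prim-quant-p1 gen 8 (lane INBOX 2026-08-21T00:17Z/00:32Z) for `Quant.BlockComb.tail_ge_of_le_marg_strong` (`…QuantBlockCombStrong.lean`,
p242699).  Theorems only (the `local notation3` of `…QuantBlockCombMergeModel.lean` and of `…QuantBlobWalk.lean`, verbatim), no definitions,
no sorries, standard axioms.  Companion: `…QuantFarRelayRowBlockCombStrong.lean` (same seat: the ancestor-finset coordinates of `Quant.FarTreeRow`
and the route vocabulary of `Quant.FarRelayRow`); p1 g8's own gate-coordinate identification (explicit chain / private gate sets, induction on the
chain length) is `…QuantFarTreeBlockCombStrong.lean`.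

**The bridge.**  p1's canonical model (`TAIL[D, q, lv, a, g, j] = Σ_{i ≤ D} pd i · Σ_S wt S · 𝟙[j+1 ≤ mass_i S]`, a DEPTH decomposition of
`P(N ≥ j+1)`) and the typer's count law on a block-comb in gate coordinates (`Quant.blockComb_count_eq`: `P(N ≥ t+1) = Σ_k w k · p k ·
(CB[k] t − CB[k](t − sz k))`, a FIRST-PASSAGE decomposition over the blobs listed root-first, `CB` the cdf recursion of `…QuantBlobWalk.lean`)
are two closed forms of the same law.  For the LEVELLED model — blobs labelled `0, …, M−1` by a bijection `lab : κ → [0, M)`, blob of label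
`k` at level `k+1` on a chain of `M` gates `qc` (so its chain weight is `W k = ∏_{i<k+1} qc i`), sizes `sz k`, gates `p k` — this file proves

* `Quant.BlockComb.sum_wt_prefixTail_eq` — `Σ_S wt S · 𝟙[t+1 ≤ mass of the blobs of label < m in S] = 1 − CB[sz, p, m] t` (the cdf
  recursion IS the configuration sum; induction on `m`, one gate split per step);
* `Quant.BlockComb.tail_eq_crossing` — **`TAIL[M, qc, lab+1, a, g, j] = Σ_{k<M} W k · p k · (CB[sz,p,k] j − CB[sz,p,k](j − sz k))`**
  (induction on the number of live leading blobs: adding blob `m` adds `W m · p m · P(S_m ∈ (j − sz m, j])`, by one gate split and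
  `Quant.BlockComb.pd_tail_sum`);
* `Quant.BlockComb.le_crossing_of_le_marg_strong` — **p1's strong-regime theorem in crossing form**: if `2j < (Σ_{k<M} sz k) · p k` for every
  live label `k` then every `x` below all live marginals `W k · p k` satisfies `x ≤ Σ_{k<M} W k p k (CB[k] j − CB[k](j − sz k))`.
In `…QuantFarRelayRowBlockCombStrong.lean` the chain gates `qc i` are the products over the SEGMENTS of the distinguished relay's chain between
consecutive attachment points, so that `W k` is exactly the chain weight `w k` of `Quant.blockComb_count_eq` and the terminal block is the
last blob (gate `1`); this turns p1's theorem into `Quant.FarTreeRow`'s conclusion for every block-comb with `2j < |A| · (every private gate)`.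
[this work]; product measure bookkeeping [cite: Grimmett1999, §1.3 p. 10].
-/

namespace Summit.CriticalPhenomena.PercolationContinuityZ3.Theorems

namespace Quant

namespace BlockComb

open Finset

variable {κ : Type*} [Fintype κ] [DecidableEq κ]

/-- product-Bernoulli weight of the set `S` of open blob gates -/
local notation3 "wt[" g ", " S "]" => ∏ k, (if k ∈ (S : Finset κ) then (g : κ → ℝ) k else 1 - (g : κ → ℝ) k)

/-- the same weight with the gate of `s` removed -/
local notation3 "wt'[" g ", " s ", " S "]" =>
  ∏ k ∈ (Finset.univ : Finset κ).erase s, (if k ∈ (S : Finset κ) then (g : κ → ℝ) k else 1 - (g : κ → ℝ) k)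

/-- probability that the chain `q` of length `D` is open exactly to depth `i` -/
local notation3 "pd[" D ", " q ", " i "]" =>
  (∏ i' ∈ Finset.range (i : ℕ), (q : ℕ → ℝ) i') * (if (i : ℕ) < (D : ℕ) then 1 - (q : ℕ → ℝ) i else 1)

/-- mass counted at depth `i` in blob configuration `S` -/
local notation3 "mass[" lv ", " a ", " i ", " S "]" =>
  ∑ k ∈ (S : Finset κ).filter (fun k => (lv : κ → ℕ) k ≤ (i : ℕ)), ((a : κ → ℕ) k : ℕ)

/-- the tail `P(N ≥ j+1)` of the block-comb count, as an explicit finite sum -/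
local notation3 "TAIL[" D ", " q ", " lv ", " a ", " g ", " j "]" =>
  ∑ i ∈ Finset.range ((D : ℕ) + 1), pd[D, q, i] *
    ∑ S : Finset κ, wt[g, S] * (if (j : ℕ) + 1 ≤ mass[lv, a, i, S] then (1 : ℝ) else 0)

/-- mass of the blobs of label `< m` in configuration `S` (sizes read on the labels) -/
local notation3 "PM[" lab ", " sz ", " m ", " S "]" =>
  ∑ k ∈ (S : Finset κ).filter (fun k => (lab : κ → ℕ) k < (m : ℕ)), ((sz : ℕ → ℕ) ((lab : κ → ℕ) k) : ℕ)

/-- `CB[a, p, m] t` = probability that the open mass of the first `m` blobs (sizes `a`, gates `p`) is `≤ t` (the recursion of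
`…QuantBlobWalk.lean`, verbatim). -/
local notation3 "CB[" a ", " p ", " m "]" =>
  (Nat.rec (motive := fun _ => ℤ → ℝ) (fun t => if (0 : ℤ) ≤ t then (1 : ℝ) else 0)
    (fun n f t => (p : ℕ → ℝ) n * f (t - ((a : ℕ → ℕ) n : ℤ)) + (1 - (p : ℕ → ℝ) n) * f t) (m : ℕ))

/-! ### 7. Bookkeeping: total weight, gate splits of functionals blind to one blob, inserting a blob at any level -/

/-- Total weight is one: `Σ_S wt S = 1`. [folklore] -/
theorem sum_wt_eq_one (g : κ → ℝ) : ∑ S : Finset κ, wt[g, S] = 1 := by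
  rw [← Finset.powerset_univ, IndepBlob.sum_powerset_prod_ite_mem]
  exact Finset.prod_eq_one fun k _ => by ring

/-- A functional blind to the state of blob `s` integrates against the weights without `s`:
`F (insert s S) = F S` for all `S ∌ s` ⟹ `Σ_S wt S · F S = Σ_S 𝟙[s ∉ S] · wt₋ₛ S · F S`. [folklore] -/
theorem sum_wt_blind (g : κ → ℝ) (s : κ) (F : Finset κ → ℝ) (hF : ∀ S, s ∉ S → F (insert s S) = F S) :
    ∑ S : Finset κ, wt[g, S] * F S = ∑ S : Finset κ, (if s ∈ S then 0 else wt'[g, s, S] * F S) := by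
  rw [sum_wt_split g s F]
  refine Finset.sum_congr rfl fun S _ => ?_
  by_cases hsS : s ∈ S
  · rw [if_pos hsS, if_pos hsS]
  · rw [if_neg hsS, if_neg hsS, hF S hsS]; ring

omit [Fintype κ] in
/-- Inserting a blob `s ∉ S` adds its size exactly when its level is counted. [folklore] -/
theorem mass_insert_if (lv : κ → ℕ) (a : κ → ℕ) (s : κ) (i : ℕ) (S : Finset κ) (hs : s ∉ S) :
    mass[lv, a, i, insert s S] = mass[lv, a, i, S] + (if lv s ≤ i then a s else 0) := by
  show (∑ k ∈ (insert s S).filter (fun k => lv k ≤ i), a k) = (∑ k ∈ S.filter (fun k => lv k ≤ i), a k) + _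
  rw [Finset.filter_insert]
  by_cases h : lv s ≤ i
  · have hs' : s ∉ S.filter (fun k => lv k ≤ i) := fun h' => hs (Finset.mem_filter.1 h').1
    rw [if_pos h, if_pos h, Finset.sum_insert hs', add_comm]
  · rw [if_neg h, if_neg h, add_zero]

omit [Fintype κ] in
/-- Inserting a blob of label `≥ m` does not change the mass of the blobs of label `< m`. [folklore] -/
theorem PM_insert_of_le (lab : κ → ℕ) (sz : ℕ → ℕ) (m : ℕ) (s : κ) (hs : m ≤ lab s) (S : Finset κ) :
    PM[lab, sz, m, insert s S] = PM[lab, sz, m, S] := by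
  show (∑ k ∈ (insert s S).filter (fun k => lab k < m), sz (lab k)) = ∑ k ∈ S.filter (fun k => lab k < m), sz (lab k)
  rw [Finset.filter_insert, if_neg (by omega)]

omit [Fintype κ] in
/-- Inserting THE blob of label `m` (labels injective) into `S ∌ s`: the mass of labels `< m+1` is the mass of labels `< m` plus `sz m`. -/
theorem PM_succ_insert (lab : κ → ℕ) (hinj : Function.Injective lab) (sz : ℕ → ℕ) (m : ℕ) (s : κ) (hs : lab s = m)
    (S : Finset κ) (hsS : s ∉ S) :
    PM[lab, sz, m + 1, insert s S] = PM[lab, sz, m, S] + sz m := by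
  show (∑ k ∈ (insert s S).filter (fun k => lab k < m + 1), sz (lab k)) = (∑ k ∈ S.filter (fun k => lab k < m), sz (lab k)) + sz m
  rw [Finset.filter_insert, if_pos (by omega)]
  have hs' : s ∉ S.filter (fun k => lab k < m + 1) := fun h' => hsS (Finset.mem_filter.1 h').1
  rw [Finset.sum_insert hs', hs, add_comm]
  congr 1
  refine Finset.sum_congr ?_ fun _ _ => rfl
  ext k
  simp only [Finset.mem_filter]
  constructor
  · rintro ⟨hk, hlt⟩
    have hks : lab k ≠ m := fun h => hsS (by rwa [← hinj (h.trans hs.symm)])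
    exact ⟨hk, by omega⟩
  · rintro ⟨hk, hlt⟩; exact ⟨hk, by omega⟩

omit [Fintype κ] [DecidableEq κ] in
/-- Without the blob of label `m` in `S`, the masses of labels `< m+1` and `< m` agree. -/
theorem PM_succ_of_notMem (lab : κ → ℕ) (hinj : Function.Injective lab) (sz : ℕ → ℕ) (m : ℕ) (s : κ) (hs : lab s = m)
    (S : Finset κ) (hsS : s ∉ S) :
    PM[lab, sz, m + 1, S] = PM[lab, sz, m, S] := by
  refine Finset.sum_congr ?_ fun _ _ => rfl
  ext k
  simp only [Finset.mem_filter]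
  constructor
  · rintro ⟨hk, hlt⟩
    have hks : lab k ≠ m := fun h => hsS (by rwa [← hinj (h.trans hs.symm)])
    exact ⟨hk, by omega⟩
  · rintro ⟨hk, hlt⟩; exact ⟨hk, by omega⟩

/-! ### 8. The cdf recursion is the configuration sum -/

/-- **`Σ_S wt S · 𝟙[t+1 ≤ mass of labels < m] = 1 − CB[sz, p, m] t`** for the labelled model (`lab : κ → ℕ` injective, every label
`< M` attained, sizes and gates read on the labels), all `m ≤ M`, `t : ℤ`. [this work] -/
theorem sum_wt_prefixTail_eq (lab : κ → ℕ) (hinj : Function.Injective lab) (M : ℕ) (hsurj : ∀ i, i < M → ∃ k, lab k = i)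
    (sz : ℕ → ℕ) (p : ℕ → ℝ) (g : κ → ℝ) (hg : ∀ k, g k = p (lab k)) :
    ∀ m, m ≤ M → ∀ t : ℤ,
      ∑ S : Finset κ, wt[g, S] * (if t + 1 ≤ ((PM[lab, sz, m, S] : ℕ) : ℤ) then (1 : ℝ) else 0) = 1 - CB[sz, p, m] t := by
  intro m
  induction m with
  | zero =>
    intro _ t
    have h0 : ∀ S : Finset κ, PM[lab, sz, 0, S] = 0 := fun S =>
      Finset.sum_eq_zero fun k hk => absurd (Finset.mem_filter.1 hk).2 (Nat.not_lt_zero _)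
    simp_rw [h0]
    rw [← Finset.sum_mul, sum_wt_eq_one, one_mul, BlobWalk.CB_zero sz p t]
    push_cast
    by_cases ht : (0 : ℤ) ≤ t
    · rw [if_pos ht, if_neg (by omega)]; ring
    · rw [if_neg ht, if_pos (by omega)]; ring
  | succ m ih =>
    intro hm t
    obtain ⟨s, hs⟩ := hsurj m (by omega)
    have ih' := ih (by omega)
    -- split at the gate of `s`
    rw [sum_wt_split g s]
    have hstep : ∀ S : Finset κ,
        (if s ∈ S then 0 else wt'[g, s, S] *
          (g s * (if t + 1 ≤ ((PM[lab, sz, m + 1, insert s S] : ℕ) : ℤ) then (1 : ℝ) else 0) +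
            (1 - g s) * (if t + 1 ≤ ((PM[lab, sz, m + 1, S] : ℕ) : ℤ) then (1 : ℝ) else 0))) =
        p m * (if s ∈ S then 0 else wt'[g, s, S] *
            (if t - (sz m : ℤ) + 1 ≤ ((PM[lab, sz, m, S] : ℕ) : ℤ) then (1 : ℝ) else 0)) +
          (1 - p m) * (if s ∈ S then 0 else wt'[g, s, S] *
            (if t + 1 ≤ ((PM[lab, sz, m, S] : ℕ) : ℤ) then (1 : ℝ) else 0)) := by
      intro S
      by_cases hsS : s ∈ S
      · simp only [if_pos hsS, mul_zero, add_zero]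
      · rw [if_neg hsS, if_neg hsS, if_neg hsS, PM_succ_insert lab hinj sz m s hs S hsS,
          PM_succ_of_notMem lab hinj sz m s hs S hsS, hg s, hs]
        have e : (t + 1 ≤ (((PM[lab, sz, m, S] + sz m : ℕ)) : ℤ)) ↔ (t - (sz m : ℤ) + 1 ≤ ((PM[lab, sz, m, S] : ℕ) : ℤ)) := by
          push_cast; omega
        rw [show (if t + 1 ≤ (((PM[lab, sz, m, S] + sz m : ℕ)) : ℤ) then (1 : ℝ) else 0) =
          (if t - (sz m : ℤ) + 1 ≤ ((PM[lab, sz, m, S] : ℕ) : ℤ) then (1 : ℝ) else 0) from by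
            by_cases h : t - (sz m : ℤ) + 1 ≤ ((PM[lab, sz, m, S] : ℕ) : ℤ)
            · rw [if_pos h, if_pos (e.2 h)]
            · rw [if_neg h, if_neg (fun h' => h (e.1 h'))]]
        ring
    rw [Finset.sum_congr rfl fun S _ => hstep S, Finset.sum_add_distrib, ← Finset.mul_sum, ← Finset.mul_sum]
    -- the functionals are blind to `s`
    have hblind : ∀ t' : ℤ, ∑ S : Finset κ, (if s ∈ S then 0 else wt'[g, s, S] *
        (if t' + 1 ≤ ((PM[lab, sz, m, S] : ℕ) : ℤ) then (1 : ℝ) else 0)) = 1 - CB[sz, p, m] t' := by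
      intro t'
      rw [← sum_wt_blind g s (fun S => (if t' + 1 ≤ ((PM[lab, sz, m, S] : ℕ) : ℤ) then (1 : ℝ) else 0))
        (fun S _ => by simp only [PM_insert_of_le lab sz m s (le_of_eq hs.symm) S])]
      exact ih' t'
    rw [hblind, hblind, BlobWalk.CB_succ sz p m t]
    ring

/-! ### 9. The depth decomposition equals the first-passage (crossing) form -/

/-- **`TAIL = crossing form` for the levelled model** (labels `lab : κ → [0, M)` bijective, blob of label `k` at level `k+1` on a chain of
`M` gates `qc`, sizes `sz`, gates `p` read on the labels), with the first `m` labels live: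
`TAIL[M, qc, lab+1, a, g, j] = Σ_{k<m} (∏_{i<k+1} qc i) · p k · (CB[sz,p,k] j − CB[sz,p,k](j − sz k))` whenever `a` agrees with `sz ∘ lab`
on labels `< m` and vanishes on labels `≥ m`. [this work] -/
theorem tail_eq_crossing_aux (lab : κ → ℕ) (hinj : Function.Injective lab) (M : ℕ) (hsurj : ∀ i, i < M → ∃ k, lab k = i)
    (sz : ℕ → ℕ) (p : ℕ → ℝ) (g : κ → ℝ) (hg : ∀ k, g k = p (lab k)) (qc : ℕ → ℝ) (j : ℕ) :
    ∀ m, m ≤ M → ∀ a : κ → ℕ, (∀ k, lab k < m → a k = sz (lab k)) → (∀ k, m ≤ lab k → a k = 0) →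
      TAIL[M, qc, (fun k => lab k + 1), a, g, j] =
        ∑ k ∈ Finset.range m, (∏ i ∈ Finset.range (k + 1), qc i) * p k *
          (CB[sz, p, k] (j : ℤ) - CB[sz, p, k] ((j : ℤ) - (sz k : ℤ))) := by
  intro m
  induction m with
  | zero =>
    intro _ a _ ha0
    rw [Finset.sum_range_zero]
    refine Finset.sum_eq_zero fun i _ => ?_
    rw [Finset.sum_eq_zero fun S _ => ?_, mul_zero]
    have hmass : mass[(fun k => lab k + 1), a, i, S] = 0 :=
      Finset.sum_eq_zero fun k _ => ha0 k (Nat.zero_le _)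
    rw [hmass, if_neg (by omega), mul_zero]
  | succ m ih =>
    intro hm a ha ha0
    obtain ⟨s, hs⟩ := hsurj m (by omega)
    -- the configuration with blob `s` deleted
    set a' := Function.update a s 0 with ha'
    have ha's : a' s = 0 := by rw [ha', Function.update_self]
    have ha'ne : ∀ k, k ≠ s → a' k = a k := fun k hk => by rw [ha', Function.update_of_ne hk]
    have hIH := ih (by omega) a' (fun k hk => by
        have hks : k ≠ s := fun h => by rw [h, hs] at hk; exact lt_irrefl _ hk
        rw [ha'ne k hks]; exact ha k (by omega))
      (fun k hk => by
        by_cases hks : k = s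
        · rw [hks, ha's]
        · rw [ha'ne k hks]
          have : lab k ≠ m := fun h => hks (hinj (h.trans hs.symm))
          exact ha0 k (by omega))
    rw [Finset.sum_range_succ (fun k => (∏ i ∈ Finset.range (k + 1), qc i) * p k *
      (CB[sz, p, k] (j : ℤ) - CB[sz, p, k] ((j : ℤ) - (sz k : ℤ)))) m, ← hIH]
    have has : a s = sz m := by rw [← hs]; exact ha s (by omega)
    -- on configurations avoiding `s` and at depths `≥ m+1`, the deleted mass is the mass of labels `< m`
    have hmassPM : ∀ i, m + 1 ≤ i → ∀ S : Finset κ, s ∉ S → mass[(fun k => lab k + 1), a', i, S] = PM[lab, sz, m, S] := by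
      intro i hi S hsS
      show (∑ k ∈ S.filter (fun k => lab k + 1 ≤ i), a' k) = ∑ k ∈ S.filter (fun k => lab k < m), sz (lab k)
      rw [Finset.sum_filter, Finset.sum_filter]
      refine Finset.sum_congr rfl fun k hk => ?_
      have hks : k ≠ s := fun h => hsS (h ▸ hk)
      by_cases hkm : lab k < m
      · rw [if_pos hkm, if_pos (by omega), ha'ne k hks, ha k (by omega)]
      · rw [if_neg hkm]
        have hkm' : m ≤ lab k := not_lt.1 hkm
        have hz : a' k = 0 := by
          rw [ha'ne k hks]
          have : lab k ≠ m := fun h => hks (hinj (h.trans hs.symm))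
          exact ha0 k (by omega)
        split_ifs <;> simp [hz]
    -- both tails split at the gate of `s`
    have hsplit1 : TAIL[M, qc, (fun k => lab k + 1), a, g, j] =
        ∑ i ∈ Finset.range (M + 1), pd[M, qc, i] *
          ∑ S : Finset κ, (if s ∈ S then 0 else wt'[g, s, S] *
            (g s * (if j + 1 ≤ mass[(fun k => lab k + 1), a', i, S] + (if lab s + 1 ≤ i then a s else 0) then (1 : ℝ) else 0) +
              (1 - g s) * (if j + 1 ≤ mass[(fun k => lab k + 1), a', i, S] then (1 : ℝ) else 0))) := by
      refine Finset.sum_congr rfl fun i _ => ?_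
      congr 1
      rw [sum_wt_split g s]
      refine Finset.sum_congr rfl fun S _ => ?_
      by_cases hsS : s ∈ S
      · simp only [if_pos hsS]
      · rw [if_neg hsS, if_neg hsS, mass_insert_if _ a s i S hsS]
        have h1 : mass[(fun k => lab k + 1), a, i, S] = mass[(fun k => lab k + 1), a', i, S] := by
          rw [ha']; exact (mass_update_of_notMem _ a s 0 i S hsS).symm
        rw [h1]
    have hsplit2 : TAIL[M, qc, (fun k => lab k + 1), a', g, j] =
        ∑ i ∈ Finset.range (M + 1), pd[M, qc, i] *
          ∑ S : Finset κ, (if s ∈ S then 0 else wt'[g, s, S] *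
            (if j + 1 ≤ mass[(fun k => lab k + 1), a', i, S] then (1 : ℝ) else 0)) := by
      refine Finset.sum_congr rfl fun i _ => ?_
      congr 1
      refine sum_wt_blind g s _ fun S hsS => ?_
      rw [mass_insert_if _ a' s i S hsS, ha's, ite_self, add_zero]
    rw [hsplit1, hsplit2, ← sub_eq_iff_eq_add', ← Finset.sum_sub_distrib]
    -- depth by depth
    have hdepth : ∀ i ∈ Finset.range (M + 1),
        pd[M, qc, i] * ∑ S : Finset κ, (if s ∈ S then 0 else wt'[g, s, S] *
            (g s * (if j + 1 ≤ mass[(fun k => lab k + 1), a', i, S] + (if lab s + 1 ≤ i then a s else 0) then (1 : ℝ) else 0) +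
              (1 - g s) * (if j + 1 ≤ mass[(fun k => lab k + 1), a', i, S] then (1 : ℝ) else 0))) -
          pd[M, qc, i] * ∑ S : Finset κ, (if s ∈ S then 0 else wt'[g, s, S] *
            (if j + 1 ≤ mass[(fun k => lab k + 1), a', i, S] then (1 : ℝ) else 0)) =
        (if m + 1 ≤ i then pd[M, qc, i] else 0) * (p m *
          (∑ S : Finset κ, (if s ∈ S then 0 else wt'[g, s, S] *
              (if ((j : ℤ) - (sz m : ℤ)) + 1 ≤ ((PM[lab, sz, m, S] : ℕ) : ℤ) then (1 : ℝ) else 0)) -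
            ∑ S : Finset κ, (if s ∈ S then 0 else wt'[g, s, S] *
              (if (j : ℤ) + 1 ≤ ((PM[lab, sz, m, S] : ℕ) : ℤ) then (1 : ℝ) else 0)))) := by
      intro i _
      by_cases hi : m + 1 ≤ i
      · rw [if_pos hi, ← mul_sub]
        congr 1
        rw [mul_sub, Finset.mul_sum, Finset.mul_sum, ← Finset.sum_sub_distrib, ← Finset.sum_sub_distrib]
        refine Finset.sum_congr rfl fun S _ => ?_
        by_cases hsS : s ∈ S
        · simp only [if_pos hsS, mul_zero, sub_zero]
        · rw [if_neg hsS, if_neg hsS, if_neg hsS, if_neg hsS, hs, if_pos hi, has, hg s, hs, hmassPM i hi S hsS]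
          have e1 : (j + 1 ≤ PM[lab, sz, m, S] + sz m) ↔ ((j : ℤ) - (sz m : ℤ) + 1 ≤ ((PM[lab, sz, m, S] : ℕ) : ℤ)) := by omega
          have e2 : (j + 1 ≤ PM[lab, sz, m, S]) ↔ ((j : ℤ) + 1 ≤ ((PM[lab, sz, m, S] : ℕ) : ℤ)) := by omega
          rw [show (if j + 1 ≤ PM[lab, sz, m, S] + sz m then (1 : ℝ) else 0) =
              (if (j : ℤ) - (sz m : ℤ) + 1 ≤ ((PM[lab, sz, m, S] : ℕ) : ℤ) then (1 : ℝ) else 0) from by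
                by_cases h : (j : ℤ) - (sz m : ℤ) + 1 ≤ ((PM[lab, sz, m, S] : ℕ) : ℤ)
                · rw [if_pos h, if_pos (e1.2 h)]
                · rw [if_neg h, if_neg (fun h' => h (e1.1 h'))],
            show (if j + 1 ≤ PM[lab, sz, m, S] then (1 : ℝ) else 0) =
              (if (j : ℤ) + 1 ≤ ((PM[lab, sz, m, S] : ℕ) : ℤ) then (1 : ℝ) else 0) from by
                by_cases h : (j : ℤ) + 1 ≤ ((PM[lab, sz, m, S] : ℕ) : ℤ)
                · rw [if_pos h, if_pos (e2.2 h)]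
                · rw [if_neg h, if_neg (fun h' => h (e2.1 h'))]]
          ring
      · rw [if_neg hi, zero_mul, ← mul_sub, ← Finset.sum_sub_distrib]
        rw [Finset.sum_eq_zero fun S _ => ?_, mul_zero]
        by_cases hsS : s ∈ S
        · simp only [if_pos hsS, sub_zero]
        · rw [if_neg hsS, if_neg hsS, hs, if_neg hi, add_zero]; ring
    -- the two configuration sums are `1 − CB[m](j − sz m)` and `1 − CB[m] j`
    have hblind : ∀ t' : ℤ, ∑ S : Finset κ, (if s ∈ S then 0 else wt'[g, s, S] *
        (if t' + 1 ≤ ((PM[lab, sz, m, S] : ℕ) : ℤ) then (1 : ℝ) else 0)) = 1 - CB[sz, p, m] t' := by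
      intro t'
      rw [← sum_wt_blind g s (fun S => (if t' + 1 ≤ ((PM[lab, sz, m, S] : ℕ) : ℤ) then (1 : ℝ) else 0))
        (fun S _ => by simp only [PM_insert_of_le lab sz m s (le_of_eq hs.symm) S])]
      exact sum_wt_prefixTail_eq lab hinj M hsurj sz p g hg m (by omega) t'
    rw [Finset.sum_congr rfl hdepth, ← Finset.sum_mul, ← Finset.sum_filter, pd_tail_sum qc M (m + 1) hm, hblind, hblind]
    ring

/-- **THEOREM (`TAIL = crossing form`).**  For the levelled canonical block-comb (labels `lab : κ → [0, M)` bijective, blob of label `k` at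
level `k+1`, chain of `M` gates `qc`, sizes `a = sz ∘ lab`, gates `g = p ∘ lab`):
`TAIL[M, qc, lab+1, a, g, j] = Σ_{k<M} (∏_{i<k+1} qc i) · p k · (CB[sz,p,k] j − CB[sz,p,k](j − sz k))` — p1's depth decomposition equals the
first-passage sum of `Quant.blockComb_count_eq`. [this work] -/
theorem tail_eq_crossing (lab : κ → ℕ) (hinj : Function.Injective lab) (M : ℕ) (hsurj : ∀ i, i < M → ∃ k, lab k = i)
    (hlt : ∀ k, lab k < M) (sz : ℕ → ℕ) (p : ℕ → ℝ) (a : κ → ℕ) (ha : ∀ k, a k = sz (lab k)) (g : κ → ℝ)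
    (hg : ∀ k, g k = p (lab k)) (qc : ℕ → ℝ) (j : ℕ) :
    TAIL[M, qc, (fun k => lab k + 1), a, g, j] =
      ∑ k ∈ Finset.range M, (∏ i ∈ Finset.range (k + 1), qc i) * p k *
        (CB[sz, p, k] (j : ℤ) - CB[sz, p, k] ((j : ℤ) - (sz k : ℤ))) :=
  tail_eq_crossing_aux lab hinj M hsurj sz p g hg qc j M le_rfl a (fun k _ => ha k)
    (fun k hk => absurd (hlt k) (not_lt.2 hk))

/-! ### 10. p1's strong-regime theorem in crossing form -/

/-- **FAR in the strong regime, crossing form** (`Quant.BlockComb.tail_ge_marg_strong` ∘ `tail_eq_crossing`).  Blobs `0, …, M−1` with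
sizes `sz k`, private gates `p k ∈ [0,1]`, blob `k` hanging at the `k+1`-st of `M` chain gates `qc i ∈ [0,1]` (chain weight
`W k = ∏_{i<k+1} qc i`): if `2j < (Σ_{k<M} sz k) · p k` for every live `k` (`sz k > 0`) and some blob is live, then SOME live blob has
`W k · p k ≤ Σ_{k<M} W k · p k · (CB[sz,p,k] j − CB[sz,p,k](j − sz k))`. [this work] -/
theorem crossing_ge_marg_strong (M : ℕ) (sz : ℕ → ℕ) (p : ℕ → ℝ) (hp : ∀ k, 0 ≤ p k ∧ p k ≤ 1) (qc : ℕ → ℝ)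
    (hqc : ∀ i, 0 ≤ qc i ∧ qc i ≤ 1) (j : ℕ)
    (hstrong : ∀ k, k < M → 0 < sz k → (2 * j : ℝ) < ((∑ k' ∈ Finset.range M, sz k' : ℕ) : ℝ) * p k)
    (hne : ∃ k, k < M ∧ 0 < sz k) :
    ∃ k, k < M ∧ 0 < sz k ∧ (∏ i ∈ Finset.range (k + 1), qc i) * p k ≤
      ∑ k ∈ Finset.range M, (∏ i ∈ Finset.range (k + 1), qc i) * p k *
        (CB[sz, p, k] (j : ℤ) - CB[sz, p, k] ((j : ℤ) - (sz k : ℤ))) := by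
  have hsum : (∑ k' : Fin M, ((sz k'.val : ℕ) : ℝ)) = ((∑ k' ∈ Finset.range M, sz k' : ℕ) : ℝ) := by
    push_cast
    exact Fin.sum_univ_eq_sum_range (fun i => (sz i : ℝ)) M
  obtain ⟨k, hk, hle⟩ := tail_ge_marg_strong (κ := Fin M) M qc hqc (fun k => k.val + 1) (fun k => sz k.val)
    (fun k => p k.val) (fun k => hp k.val) j (fun k _ => k.2)
    (fun k hk => by rw [hsum]; exact hstrong k.val k.2 hk) (by obtain ⟨k, hkM, hk⟩ := hne; exact ⟨⟨k, hkM⟩, hk⟩)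
  rw [tail_eq_crossing (κ := Fin M) (fun k => k.val) Fin.val_injective M (fun i hi => ⟨⟨i, hi⟩, rfl⟩) (fun k => k.2)
    sz p (fun k => sz k.val) (fun _ => rfl) (fun k => p k.val) (fun _ => rfl) qc j] at hle
  exact ⟨k.val, k.2, hk, hle⟩

/-- **COROLLARY.**  Under the hypotheses of `crossing_ge_marg_strong`, every `x` below all live marginals `W k · p k` satisfies
`x ≤ Σ_{k<M} W k · p k · (CB[sz,p,k] j − CB[sz,p,k](j − sz k))` — the right-hand side of `Quant.blockComb_count_eq` once the terminal block is
listed as the last blob (gate `1`). [this work] -/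
theorem le_crossing_of_le_marg_strong (M : ℕ) (sz : ℕ → ℕ) (p : ℕ → ℝ) (hp : ∀ k, 0 ≤ p k ∧ p k ≤ 1) (qc : ℕ → ℝ)
    (hqc : ∀ i, 0 ≤ qc i ∧ qc i ≤ 1) (j : ℕ)
    (hstrong : ∀ k, k < M → 0 < sz k → (2 * j : ℝ) < ((∑ k' ∈ Finset.range M, sz k' : ℕ) : ℝ) * p k)
    (hne : ∃ k, k < M ∧ 0 < sz k) (x : ℝ)
    (hx : ∀ k, k < M → 0 < sz k → x ≤ (∏ i ∈ Finset.range (k + 1), qc i) * p k) :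
    x ≤ ∑ k ∈ Finset.range M, (∏ i ∈ Finset.range (k + 1), qc i) * p k *
        (CB[sz, p, k] (j : ℤ) - CB[sz, p, k] ((j : ℤ) - (sz k : ℤ))) := by
  obtain ⟨k, hkM, hk, hle⟩ := crossing_ge_marg_strong M sz p hp qc hqc j hstrong hne
  exact (hx k hkM hk).trans hle

end BlockComb

end Quant

end Summit.CriticalPhenomena.PercolationContinuityZ3.Theorems
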